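import Literature.Computability.ImplicitComplexity.SoftTypeAssignmentMachineSound
import HarnessLib

/-!
# A sharing abstract machine for `STA₊`, IV: the potential and the classification of transitions

Preparation of the completeness proof of the machine `STA.KAM` (GMR08 = Gaboardi–Marion–Ronchi
Della Rocca 2008, §5.1, Table 6): the size invariant `KAM.Small` (all codes are bounded — they are
subterms of the initial term), the potential `KAM.phi` = `(2 - depth, rank of the environment,
|code|)` weighted lexicographically, which the silent transitions (push, look-up, enter) strictly
decrease, and the classification of the transitions of a well-formed state into silent ones,
`β`-steps (label `none`) and choices consuming one oracle bit (`KAM.step_cases`), together with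
the description of the rejecting configurations (`KAM.step_reject`). Also: two leftmost steps
from the same term are of the same kind (`LmoL.isSome_eq`).

## References

* [GaboardiMarionRonchidellarocca2008] GMR08, §5.1, Table 6, Lemma 5.9–5.11 (space).
-/

namespace Literature.Computability.ImplicitComplexity

namespace STA

/-- Two labelled leftmost steps from the same term are of the same kind (β/inner vs. choice).
[folklore] -/
theorem LmoL.isSome_eq {b₁ b₂ : Option Bool} {M N₁ N₂ : Term} (h₁ : LmoL b₁ M N₁) (h₂ : LmoL b₂ M N₂) :
    b₁.isSome = b₂.isSome := by
  induction h₁ generalizing N₂ with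
  | @hd M₀ M₀' h =>
    have key : ∀ {N}, HdL b₂ M₀ N → b₁.isSome = b₂.isSome := by
      intro N h'
      cases b₁ with
      | none =>
        cases b₂ with
        | none => rfl
        | some bb =>
          obtain ⟨P, hP⟩ := h.spineHead.1 rfl
          obtain ⟨t, u, htu⟩ := h'.spineHead.2 bb rfl
          rw [hP] at htu; cases htu
      | some bb =>
        cases b₂ with
        | some _ => rfl
        | none =>
          obtain ⟨P, hP⟩ := h'.spineHead.1 rfl
          obtain ⟨t, u, htu⟩ := h.spineHead.2 bb rfl
          rw [hP] at htu; cases htu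
    cases h₂ with
    | hd h' => exact key h'
    | lam _ => cases h
    | appL N hM h' =>
      cases h with
      | beta => cases hM
      | appL _ h => exact absurd h.toHd (fun hh => hM.not_hd hh)
    | appR hM hn h' =>
      cases h with
      | beta => cases hM
      | appL _ h => exact absurd h.toHd (fun hh => hM.not_hd hh)
  | lam _ ih =>
    cases h₂ with
    | hd h' => cases h'
    | lam h' => exact ih h'
  | appL N hM h ih =>
    cases h₂ with
    | hd h' =>
      cases h' with
      | beta => cases hM
      | appL _ h' => exact absurd h'.toHd (fun hh => hM.not_hd hh)
    | appL _ _ h' => exact ih h'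
    | appR _ hn h' => exact absurd h.lmo.red (hn _)
  | appR hM hn h ih =>
    cases h₂ with
    | hd h' =>
      cases h' with
      | beta => cases hM
      | appL _ h' => exact absurd h'.toHd (fun hh => hM.not_hd hh)
    | appL _ _ h' => exact absurd h'.lmo.red (hn _)
    | appR _ _ h' => exact ih h'

/-- `λᴰ (P + Q) a⃗` is not `0`. [folklore] -/
theorem lams_apps_sum_ne_zero (D : ℕ) (P Q : Term) (args : List Term) : KAM.lams D (KAM.apps (.sum P Q) args) ≠ zero := by
  have hsp : spineHead (KAM.apps (.sum P Q) args) = .sum P Q := by rw [spineHead_apps]; rfl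
  intro h
  rcases D with _ | _ | _ | D
  · simp only [KAM.lams] at h
    rw [h] at hsp
    simp [zero, spineHead] at hsp
  · simp only [KAM.lams, zero, Term.lam.injEq] at h
    rw [h] at hsp
    simp [spineHead] at hsp
  · simp only [KAM.lams, zero, Term.lam.injEq] at h
    rw [h] at hsp
    simp [spineHead] at hsp
  · simp [KAM.lams, zero] at h

namespace KAM

/-! ### Size invariant and potential -/

/-- All codes in a state have size at most `Z`. [folklore] -/
structure Small (Z : ℕ) (s : State) : Prop where
  /-- the code is small -/
  code : s.code.size ≤ Z
  /-- the pending arguments are small -/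
  stack : ∀ cl ∈ s.stack, cl.1.size ≤ Z
  /-- the bound closures are small -/
  heap : ∀ (c : ℕ) (t : Term) (env : List ℕ), s.heap[c]? = some (Entry.clo t env) → t.size ≤ Z

/-- The initial state is small for `Z = |T|`. [folklore] -/
theorem Small.init (T : Term) : Small T.size (init T) where
  code := le_rfl
  stack := by simp [KAM.init]
  heap := by simp [KAM.init]

/-- One plus the largest pointer of an environment (`0` for the empty one). [folklore] -/
def envRank (env : List ℕ) : ℕ := env.foldr (fun c m => max (c + 1) m) 0

/-- Members are below the rank. [folklore] -/
theorem lt_envRank {env : List ℕ} {c : ℕ} (h : c ∈ env) : c < envRank env := by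
  induction env with
  | nil => cases h
  | cons a env ih =>
    simp only [envRank, List.foldr_cons]
    rcases List.mem_cons.1 h with rfl | h
    · exact Nat.lt_of_lt_of_le (Nat.lt_succ_self _) (le_max_left _ _)
    · exact Nat.lt_of_lt_of_le (ih h) (le_max_right _ _)

/-- The rank is below any strict bound of the members. [folklore] -/
theorem envRank_le {env : List ℕ} {n : ℕ} (h : ∀ c ∈ env, c < n) : envRank env ≤ n := by
  induction env with
  | nil => exact Nat.zero_le _
  | cons a env ih =>
    simp only [envRank, List.foldr_cons]
    exact max_le (h a (by simp)) (ih fun c hc => h c (by simp [hc]))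

/-- The potential: `(2 - depth, rank of the environment, |code|)` weighted so as to be
lexicographic below the bounds `R` (pointers) and `Z` (sizes). [folklore] -/
def phi (R Z : ℕ) (s : State) : ℕ :=
  (2 - s.depth) * ((R + 1) * (Z + 1)) + envRank s.env * (Z + 1) + s.code.size

/-- The potential is below `3 (R+1)(Z+1)`. [folklore] -/
theorem phi_lt {R Z : ℕ} {s : State} (hwf : WF s) (hsm : Small Z s) (hR : s.heap.length ≤ R) :
    phi R Z s < 3 * ((R + 1) * (Z + 1)) := by
  have h1 : (2 - s.depth) * ((R + 1) * (Z + 1)) ≤ 2 * ((R + 1) * (Z + 1)) :=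
    Nat.mul_le_mul_right _ (Nat.sub_le _ _)
  have h2 : envRank s.env ≤ R := (envRank_le hwf.envPtr).trans hR
  have h3 : envRank s.env * (Z + 1) ≤ R * (Z + 1) := Nat.mul_le_mul_right _ h2
  have h4 := hsm.code
  unfold phi
  nlinarith

/-! ### The transitions, classified -/

/-- **Classification of the transitions** of a well-formed small state whose heap stays below `R`:
silent (same represented term, same oracle, potential down, heap-plus-free-depth unchanged), a
`β`-step (label `none`, one more heap cell), or a choice consuming one oracle bit.
[cite: GaboardiMarionRonchidellarocca2008, Table 6] -/
theorem step_cases {R Z : ℕ} {o o' : List Bool} {s s' : State} (hwf : WF s) (hsm : Small Z s)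
    (hR : s.heap.length + 1 ≤ R) (h : step o s = .go o' s') :
    WF s' ∧ Small Z s' ∧
    ((o' = o ∧ rd s' = rd s ∧ phi R Z s' < phi R Z s ∧
        s'.heap.length + (2 - s'.depth) = s.heap.length + (2 - s.depth)) ∨
     (o' = o ∧ LmoL none (rd s) (rd s') ∧ s'.heap.length = s.heap.length + 1 ∧ s'.depth = s.depth) ∨
     (∃ bb, o = bb :: o' ∧ LmoL (some bb) (rd s) (rd s') ∧ s'.heap.length = s.heap.length ∧ s'.depth = s.depth)) := by
  obtain ⟨code, env, stack, heap, depth⟩ := s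
  obtain ⟨smCode, smStack, smHeap⟩ := hsm
  dsimp only at smCode smStack smHeap hR
  cases code with
  | app t u =>
    simp only [step, Res.go.injEq] at h
    obtain ⟨rfl, rfl⟩ := h
    obtain ⟨hwf', hrd⟩ := step_app hwf
    refine ⟨hwf', ⟨by simp [Term.size] at smCode ⊢; omega, ?_, smHeap⟩, Or.inl ⟨rfl, hrd, ?_, rfl⟩⟩
    · intro cl hcl
      rcases List.mem_cons.1 hcl with rfl | hcl
      · simp [Term.size] at smCode ⊢; omega
      · exact smStack cl hcl
    · simp only [phi, Term.size]
      omega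
  | lam t =>
    cases stack with
    | cons c S =>
      simp only [step, Res.go.injEq] at h
      obtain ⟨rfl, rfl⟩ := h
      obtain ⟨hwf', hl⟩ := step_beta hwf
      refine ⟨hwf', ⟨by simp [Term.size] at smCode ⊢; omega, fun cl hcl => smStack cl (by simp [hcl]), ?_⟩,
        Or.inr (Or.inl ⟨rfl, hl, by simp, rfl⟩)⟩
      intro c' t' env' hget
      rcases Nat.lt_or_ge c' heap.length with hlt | hge
      · rw [List.getElem?_append_left hlt] at hget
        exact smHeap c' t' env' hget
      · obtain ⟨_, hx⟩ := getElem?_snoc_of_ge hge hget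
        simp only [Entry.clo.injEq] at hx
        obtain ⟨rfl, rfl⟩ := hx
        exact smStack c (by simp)
    | nil =>
      simp only [step] at h
      by_cases hd : depth < 2
      · rw [if_pos hd] at h
        simp only [Res.go.injEq] at h
        obtain ⟨rfl, rfl⟩ := h
        obtain ⟨hwf', hrd⟩ := step_enter hwf hd
        refine ⟨hwf', ⟨by simp [Term.size] at smCode ⊢; omega, by simp, ?_⟩, Or.inl ⟨rfl, hrd, ?_, ?_⟩⟩
        · intro c' t' env' hget
          rcases Nat.lt_or_ge c' heap.length with hlt | hge
          · rw [List.getElem?_append_left hlt] at hget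
            exact smHeap c' t' env' hget
          · obtain ⟨_, hx⟩ := getElem?_snoc_of_ge hge hget
            cases hx
        · have hEnv : ∀ c ∈ env, c < heap.length := hwf.envPtr
          show (2 - (depth + 1)) * ((R + 1) * (Z + 1)) + envRank (heap.length :: env) * (Z + 1) + t.size <
            (2 - depth) * ((R + 1) * (Z + 1)) + envRank env * (Z + 1) + (t.size + 1)
          have h1 : envRank (heap.length :: env) ≤ R := envRank_le fun c' hc' => by
            rcases List.mem_cons.1 hc' with rfl | hc'
            · omega
            · have := hEnv c' hc'; omega
          have h3 : envRank (heap.length :: env) * (Z + 1) ≤ R * (Z + 1) := Nat.mul_le_mul_right _ h1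
          have hA : R * (Z + 1) < (R + 1) * (Z + 1) := by rw [Nat.succ_mul]; omega
          have e : 2 - depth = (2 - (depth + 1)) + 1 := by omega
          generalize hAdef : (R + 1) * (Z + 1) = A at hA ⊢
          rw [e, add_one_mul]
          omega
        · simp only [List.length_append, List.length_singleton]
          omega
      · rw [if_neg hd] at h
        cases h
  | sum t u =>
    cases o with
    | nil => simp [step] at h
    | cons bb o₀ =>
      simp only [step, Res.go.injEq] at h
      obtain ⟨rfl, rfl⟩ := h
      obtain ⟨hwf', hl⟩ := step_sum hwf bb
      exact ⟨hwf', ⟨by cases bb <;> simp [Term.size] at smCode ⊢ <;> omega, smStack, smHeap⟩,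
        Or.inr (Or.inr ⟨bb, rfl, hl, rfl, rfl⟩)⟩
  | var i =>
    rcases hget : env[i]? with _ | c
    · simp [step, hget] at h
    · rcases hcell : heap[c]? with _ | ⟨t', env'⟩ | ℓ
      · simp [step, hget, hcell] at h
      · simp only [step, hget, hcell, Res.go.injEq] at h
        obtain ⟨rfl, rfl⟩ := h
        obtain ⟨hwf', hrd⟩ := step_var hwf hget hcell
        have h1 := (hwf.heapClo c t' env' hcell).1
        refine ⟨hwf', ⟨smHeap c t' env' hcell, smStack, smHeap⟩, Or.inl ⟨rfl, hrd, ?_, rfl⟩⟩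
        simp only [phi]
        have hr1 : envRank env' ≤ c := envRank_le h1
        have hr2 : c < envRank env := lt_envRank (List.mem_of_getElem? hget)
        have hs1 := smHeap c t' env' hcell
        have : envRank env' + 1 ≤ envRank env := by omega
        have : (envRank env' + 1) * (Z + 1) ≤ envRank env * (Z + 1) := Nat.mul_le_mul_right _ this
        nlinarith
      · simp only [step, hget, hcell] at h
        split_ifs at h

/-- **The rejecting configurations** of a well-formed state. [folklore] -/
theorem step_reject {o : List Bool} {s : State} (hwf : WF s) (h : step o s = .reject) :
    (∃ t, s.code = .lam t ∧ s.stack = [] ∧ s.depth = 2) ∨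
    (∃ t u, s.code = .sum t u ∧ o = []) ∨
    (∃ i c ℓ, s.code = .var i ∧ s.env[i]? = some c ∧ s.heap[c]? = some (Entry.abs ℓ) ∧
      ¬(s.stack = [] ∧ s.depth = 2 ∧ ℓ = 0)) := by
  obtain ⟨code, env, stack, heap, depth⟩ := s
  cases code with
  | app t u => simp [step] at h
  | lam t =>
    cases stack with
    | cons c S => simp [step] at h
    | nil =>
      simp only [step] at h
      have hd : depth ≤ 2 := hwf.depthLe
      split_ifs at h with hlt
      have hlt' : ¬ depth < 2 := hlt
      exact Or.inl ⟨t, rfl, rfl, by change depth = 2; omega⟩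
  | sum t u =>
    cases o with
    | nil => exact Or.inr (Or.inl ⟨t, u, rfl, rfl⟩)
    | cons b o' => simp [step] at h
  | var i =>
    rcases hget : env[i]? with _ | c
    · have hi : i < env.length := hwf.codeFv i (by simp)
      exact absurd hget (by rw [List.getElem?_eq_none_iff]; omega)
    · have hc : c < heap.length := hwf.envPtr c (List.mem_of_getElem? hget)
      rcases hcell : heap[c]? with _ | ⟨t', env'⟩ | ℓ
      · exact absurd hcell (by rw [List.getElem?_eq_none_iff]; omega)
      · simp [step, hget, hcell] at h
      · simp only [step, hget, hcell] at h
        split_ifs at h with hcond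
        refine Or.inr (Or.inr ⟨i, c, ℓ, rfl, hget, hcell, fun h' => hcond ?_⟩)
        exact ⟨List.isEmpty_iff.2 h'.1, h'.2⟩

/-- The represented term of a state whose head is an abstract variable. [folklore] -/
theorem rd_var_abs {i c ℓ : ℕ} {env : List ℕ} {stack : List (Term × List ℕ)} {heap : List Entry} {depth : ℕ}
    (hwf : WF ⟨.var i, env, stack, heap, depth⟩) (hget : env[i]? = some c) (hcell : heap[c]? = some (Entry.abs ℓ)) :
    rd ⟨.var i, env, stack, heap, depth⟩ =
      lams depth (apps (.var (depth - 1 - ℓ)) (stack.map fun cl => rbClo heap depth heap.length cl.1 cl.2)) := by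
  have hc : c < heap.length := hwf.envPtr c (List.mem_of_getElem? hget)
  simp only [rd, rbClo, Term.substp, rbEnv, hget, Option.elim]
  rw [rbCell_eq_succ heap depth hc, rbCell_abs hcell]

end KAM

end STA

end Literature.Computability.ImplicitComplexity
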